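import Literature.Algebra.Homology.DiscreteRepLayerColimitGroupCohomology
import Mathlib.Topology.Algebra.ClopenNhdofOne
import HarnessLib

/-!
# The colimit theorem (d) AT AN OPEN SUBGROUP: the layers of `(U, Res_U M)` are cofinally the traces
# `V ∩ U` of the open normal subgroups `V ≤ U` of `Γ` (Serre, *Galois Cohomology* I §2.2 Prop. 8;
# Harari §4.3 (2)–(3))

Topic `Algebra/Homology`; namespace `Literature.Algebra.Homology.DiscreteRep` (auxiliary statements in
`DiscreteRep.LayerColimit`).  One definition with body (`traceOpenNormalSubgroup U V`, the trace `V ∩ U`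
of an open normal subgroup `V ≤ Γ` on a subgroup `U`, as an open normal subgroup of `U`) and theorems;
no named fact, no instance, no `sorry`.  Sequel of `DiscreteRepLayerColimitGroupCohomology` (door-c4 g15:
(d) in `groupCohomology` currency, `stepG`, `ext_eq_zero_of_forall_exists_stepG_eq_zero`).

THE POINT.  Door-c4's Tate duality theorem (`DiscreteRepTateDuality.TateDualityHypotheses`) asks for the
class-formation data of `C ∈ C_Γ` at EVERY open normal subgroup `U ≤ Γ`: `Ext¹_{C_U}(ℤ, Res_U C) = 0`,
`Extʳ_{C_U}(ℤ, Res_U C) = 0` (`r ≥ 3`), …, i.e. statements about the profinite group `U` and the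
restricted object `Res_U C`.  The colimit theorem (d) for the group `U` runs over ALL open normal subgroups
`W ≤ U`; but for `Γ` profinite and `U` open, the traces `V ∩ U = V` of the open normal subgroups `V ≤ U` OF
`Γ` are cofinal among them (`exists_traceOpenNormalSubgroup_le`: an open subgroup of `U` is open in `Γ`,
hence contains an open normal subgroup of `Γ` — Mathlib
`ProfiniteGrp.exist_openNormalSubgroup_sub_open_nhds_of_one`), and at such a layer the layer module
`(Res_U M)^{V ∩ U}` has the same vectors as `M^V` (`coe_traceLayer_mem_invariants`).  Hence the
**vanishing transfer at `U`** (`ext_res_eq_zero_of_forall_trace`): if every class of every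
`Hⁿ(U ⧸ (V ∩ U), (Res_U M)^{V ∩ U})`, `V ≤ U` open normal in `Γ`, dies under the transition to some deeper
trace layer `V' ≤ V`, then `Extⁿ_{C_U}(k, Res_U M) = 0`; in particular (`ext_res_eq_zero_of_forall_trace_eq_zero`)
if all these layer groups vanish.  The identification of the trace layers with the cell's finite Galois
layers (`Hⁿ(H_E, Res C_E)`, `H_E ≤ Gal(E/F)` the image of `U`) is the sequel
`NumberTheory/GaloisRepresentations/GalLayerSystemSubgroupLayers.lean`.

Written for Route A of the Poitou–Tate programme of crux `stmt-BirchSwinnertonDyer-19295` (cell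
`bsd-schneider-ideate`, seat door-c6 gen 15).  HONEST FRAMING: homological algebra / topological groups
only; no arithmetic statement and no case of BSD is proved here.

## References
* J.-P. Serre, *Galois Cohomology*, Springer (1997), I §2.2 Proposition 8
  (`H^q(G, A) = lim→ H^q(G/U, A^U)`, over any cofinal family of open normal subgroups). [SerreGaloisCohomology1997]
* D. Harari, *Galois Cohomology and Class Field Theory*, Universitext (2020), §4.3 (2)–(3)
  (open subgroups of profinite groups, restriction). [Harari2020]
-/

noncomputable section

universe u

namespace Literature.Algebra.Homology

namespace DiscreteRep

open CategoryTheory CategoryTheory.Limits CategoryTheory.Abelian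

variable {k Γ : Type u} [CommRing k] [Group Γ] [TopologicalSpace Γ] [IsTopologicalGroup Γ]

/-! ## §1 The trace of an open normal subgroup of `Γ` on a subgroup `U` -/

/-- **The trace `V ∩ U` of an open normal subgroup `V ≤ Γ` on a subgroup `U`, as an open normal subgroup of
`U`** (Mathlib `Subgroup.subgroupOf`, i.e. the preimage under `U ↪ Γ`; open and normal as a preimage).
[cite: SerreGaloisCohomology1997, I §2.2 Proposition 8] -/
def traceOpenNormalSubgroup (U : Subgroup Γ) (V : OpenNormalSubgroup Γ) : OpenNormalSubgroup U where
  toSubgroup := (V : Subgroup Γ).subgroupOf U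
  isOpen' := (LayerColimit.coe_isOpen V).preimage continuous_subtype_val
  isNormal' := Subgroup.Normal.subgroupOf inferInstance U

omit [IsTopologicalGroup Γ] in
/-- Membership in the trace: `u ∈ V ∩ U ↔ (u : Γ) ∈ V`. [cite: SerreGaloisCohomology1997, I §2.2 Proposition 8] -/
theorem mem_traceOpenNormalSubgroup_iff (U : Subgroup Γ) (V : OpenNormalSubgroup Γ) (u : U) :
    u ∈ traceOpenNormalSubgroup U V ↔ (u : Γ) ∈ (V : Subgroup Γ) := Iff.rfl

omit [IsTopologicalGroup Γ] in
/-- The trace as a subgroup of `U` is `V.subgroupOf U`. [cite: SerreGaloisCohomology1997, I §2.2 Proposition 8] -/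
theorem coe_traceOpenNormalSubgroup (U : Subgroup Γ) (V : OpenNormalSubgroup Γ) :
    (traceOpenNormalSubgroup U V : Subgroup U) = (V : Subgroup Γ).subgroupOf U := rfl

omit [IsTopologicalGroup Γ] in
/-- The trace is monotone in `V`. [cite: SerreGaloisCohomology1997, I §2.2 Proposition 8] -/
theorem traceOpenNormalSubgroup_mono (U : Subgroup Γ) {V V' : OpenNormalSubgroup Γ}
    (h : (V' : Subgroup Γ) ≤ V) :
    (traceOpenNormalSubgroup U V' : Subgroup U) ≤ traceOpenNormalSubgroup U V := fun _ hu => h hu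

/-- **Cofinality**: for `Γ` profinite and `U` open, every open normal subgroup `W` of `U` contains the trace
of an open normal subgroup `V ≤ U` of `Γ` (`W` is open in `Γ`, so it contains an open normal subgroup of
`Γ`; Mathlib `ProfiniteGrp.exist_openNormalSubgroup_sub_open_nhds_of_one`).
[cite: SerreGaloisCohomology1997, I §2.2 Proposition 8][cite: Harari2020, §4.3 (2)] -/
theorem exists_traceOpenNormalSubgroup_le [CompactSpace Γ] [TotallyDisconnectedSpace Γ] (U : Subgroup Γ)
    (hU : IsOpen (U : Set Γ)) (W : OpenNormalSubgroup U) :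
    ∃ V : OpenNormalSubgroup Γ, (V : Subgroup Γ) ≤ U ∧
      (traceOpenNormalSubgroup U V : Subgroup U) ≤ (W : Subgroup U) := by
  have hWo : IsOpen (((↑) : U → Γ) '' ((W : Subgroup U) : Set U)) :=
    hU.isOpenMap_subtype_val _ (LayerColimit.coe_isOpen W)
  have h1 : (1 : Γ) ∈ ((↑) : U → Γ) '' ((W : Subgroup U) : Set U) := ⟨1, (W : Subgroup U).one_mem, rfl⟩
  obtain ⟨V, hV⟩ := ProfiniteGrp.exist_openNormalSubgroup_sub_open_nhds_of_one hWo h1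
  refine ⟨V, fun γ hγ => ?_, fun u hu => ?_⟩
  · obtain ⟨w, -, rfl⟩ := hV hγ
    exact w.2
  · obtain ⟨w, hw, hwu⟩ := hV ((mem_traceOpenNormalSubgroup_iff U V u).1 hu)
    obtain rfl : w = u := Subtype.ext hwu
    exact hw

/-! ## §2 The trace layers of `Res_U M` -/

section Layers

variable (U : Subgroup Γ) (V : OpenNormalSubgroup Γ) (M : DiscreteRepCat k Γ)

omit [IsTopologicalGroup Γ] in
/-- The vectors of the trace layer `(Res_U M)^{V ∩ U}` are `V`-invariant vectors of `M` when `V ≤ U`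
(same underlying module `M`). [cite: SerreGaloisCohomology1997, I §2.2 Proposition 8] -/
theorem coe_traceLayer_mem_invariants (hVU : (V : Subgroup Γ) ≤ U)
    (x : (((resD k U).obj M).obj.quotientToInvariants (traceOpenNormalSubgroup U V : Subgroup U)).V) :
    (x.1 : M.obj.V) ∈ Representation.invariants (M.obj.ρ.comp (V : Subgroup Γ).subtype) := fun v =>
  x.2 ⟨⟨v.1, hVU v.2⟩, v.2⟩

omit [IsTopologicalGroup Γ] in
/-- Conversely a `V`-invariant vector of `M` is a vector of the trace layer `(Res_U M)^{V ∩ U}`.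
[cite: SerreGaloisCohomology1997, I §2.2 Proposition 8] -/
theorem mem_invariants_traceLayer (x : M.obj.V)
    (hx : x ∈ Representation.invariants (M.obj.ρ.comp (V : Subgroup Γ).subtype)) :
    x ∈ Representation.invariants
      (((resD k U).obj M).obj.ρ.comp (traceOpenNormalSubgroup U V : Subgroup U).subtype) := fun w =>
  hx ⟨(w.1 : Γ), w.2⟩

end Layers

/-! ## §3 The vanishing transfer at an open subgroup -/

namespace LayerColimit

variable [CompactSpace Γ] [TotallyDisconnectedSpace Γ]

omit [TotallyDisconnectedSpace Γ] in
/-- `U` open in a compact group is compact (it is closed). [cite: Harari2020, §4.3 (2)] -/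
theorem compactSpace_subgroup_of_isOpen (U : Subgroup Γ) (hU : IsOpen (U : Set Γ)) : CompactSpace U :=
  isCompact_iff_compactSpace.1 (U.isClosed_of_isOpen hU).isCompact

/-- **VANISHING TRANSFER AT AN OPEN SUBGROUP `U`** (`Γ` profinite): if for every open normal subgroup
`V ≤ U` of `Γ` every class of the trace layer `Hⁿ(U ⧸ (V ∩ U), (Res_U M)^{V ∩ U})` is killed by the
transition to the trace of some open normal `V' ≤ V`, then `Extⁿ_{C_U}(k, Res_U M) = 0`
(cofinality `exists_traceOpenNormalSubgroup_le` + door-c4's `ext_eq_zero_of_forall_exists_stepG_eq_zero` for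
the group `U`). [cite: SerreGaloisCohomology1997, I §2.2 Proposition 8][cite: Harari2020, §4.3 (2)–(3)] -/
theorem ext_res_eq_zero_of_forall_trace (U : Subgroup Γ) (hU : IsOpen (U : Set Γ)) (n : ℕ)
    (M : DiscreteRepCat k Γ)
    (h : ∀ (V : OpenNormalSubgroup Γ), (V : Subgroup Γ) ≤ U →
      ∀ c : groupCohomology ((invariantsQuotFunctor k
        (traceOpenNormalSubgroup U V : Subgroup U)).obj ((resD k U).obj M)) n,
      ∃ (V' : OpenNormalSubgroup Γ) (hV' : (V' : Subgroup Γ) ≤ V),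
        stepG (traceOpenNormalSubgroup U V) (traceOpenNormalSubgroup U V')
          (traceOpenNormalSubgroup_mono U hV') ((resD k U).obj M) n c = 0)
    (x : Ext (triv (Γ := U) k) ((resD k U).obj M) n) : x = 0 := by
  haveI := compactSpace_subgroup_of_isOpen U hU
  refine ext_eq_zero_of_forall_exists_stepG_eq_zero n ((resD k U).obj M) (fun W c => ?_) x
  obtain ⟨V, hVU, hVW⟩ := exists_traceOpenNormalSubgroup_le U hU W
  obtain ⟨V', hV', h0⟩ := h V hVU (stepG W (traceOpenNormalSubgroup U V) hVW ((resD k U).obj M) n c)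
  refine ⟨traceOpenNormalSubgroup U V', (traceOpenNormalSubgroup_mono U hV').trans hVW, ?_⟩
  have e := stepG_stepG W (traceOpenNormalSubgroup U V) hVW ((resD k U).obj M) n
    (traceOpenNormalSubgroup U V') (traceOpenNormalSubgroup_mono U hV') c
  rw [← e]
  exact h0

/-- **Corollary: if every trace layer group `Hⁿ(U ⧸ (V ∩ U), (Res_U M)^{V ∩ U})` (`V ≤ U` open normal in
`Γ`) vanishes, then `Extⁿ_{C_U}(k, Res_U M) = 0`** — the form used for `H¹` (class-formation axiom I at
every subgroup of every finite layer) and `H³`. [cite: SerreGaloisCohomology1997, I §2.2 Proposition 8] -/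
theorem ext_res_eq_zero_of_forall_trace_eq_zero (U : Subgroup Γ) (hU : IsOpen (U : Set Γ)) (n : ℕ)
    (M : DiscreteRepCat k Γ)
    (h : ∀ (V : OpenNormalSubgroup Γ), (V : Subgroup Γ) ≤ U →
      ∀ c : groupCohomology ((invariantsQuotFunctor k
        (traceOpenNormalSubgroup U V : Subgroup U)).obj ((resD k U).obj M)) n, c = 0)
    (x : Ext (triv (Γ := U) k) ((resD k U).obj M) n) : x = 0 :=
  ext_res_eq_zero_of_forall_trace U hU n M
    (fun V hVU c => ⟨V, le_rfl, by rw [h V hVU c, map_zero]⟩) x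

/-- **The case `U = Γ` read through a cofinal family**: if for every open normal `V` of `Γ` every class of
`Hⁿ(Γ ⧸ V, M^V)` is killed by SOME deeper transition, `Extⁿ_{C_Γ}(k, M) = 0` — restated here only to record
that the absolute statement is door-c4's `ext_eq_zero_of_forall_exists_stepG_eq_zero` itself (no trace needed).
[cite: SerreGaloisCohomology1997, I §2.2 Proposition 8] -/
theorem ext_eq_zero_of_forall_exists_stepG_eq_zero' (n : ℕ) (M : DiscreteRepCat k Γ)
    (h : ∀ (V : OpenNormalSubgroup Γ)
      (c : groupCohomology ((invariantsQuotFunctor k (V : Subgroup Γ)).obj M) n),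
      ∃ (V' : OpenNormalSubgroup Γ) (hV' : (V' : Subgroup Γ) ≤ V), stepG V V' hV' M n c = 0)
    (x : Ext (triv (Γ := Γ) k) M n) : x = 0 :=
  ext_eq_zero_of_forall_exists_stepG_eq_zero n M h x

end LayerColimit

end DiscreteRep

end Literature.Algebra.Homology

end
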